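import Literature.Analysis.Pluripotential.RegularisedMax
import HarnessLib

/-!
# The clamped nonlinearities `v^p` (`p < 1`) and `−log v` of Nash's lower bound argument

Analysis/FluidPDE proofs file (theorems only), on the discharge path of the named fact
`Literature.Analysis.FluidPDE.LeiZhang2011_liouville` (Z. Lei, Q. S. Zhang, J. Funct. Anal. 261
(2011) = arXiv:1011.5066). In §3 the equation (1.5) is tested for a positive solution
`Φ_ε = Φ + ε ≥ ε` with the concave power `pΦ^{p−1}` (Lemma 3.4: "Let us test (1.5) by
`pΦ^{p−1}ψ²`, `p ∈ (0, ½)`") and with `ψ²/Φ` (Lemma 3.2: `Ψ = −ln Φ̃`). The tree's energy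
identities take a globally `C²` nonlinearity `H : ℝ → ℝ`; the functions `v^p`, `−log v` are
smooth only on `(0, ∞)`. Since only the values of `H` on the range `[ε, ∞)` of `Φ_ε` matter, we
clamp the argument smoothly from below with the tree's regularised maximum
`smoothMax (ε/4) v (ε/4)` (`= v` for `v ≥ ε/2`, `≥ ε/4 > 0` always, `C^∞`):

* `H_p(v) = (smoothMax (ε/4) v (ε/4))^p`, `H_log(v) = −log (smoothMax (ε/4) v (ε/4))` are
  `C^∞(ℝ)` and positive resp. defined everywhere;
* for `v > ε/2` they agree with `v^p`, `−log v` near `v`, so their first and second derivatives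
  are `p v^{p−1}`, `p(p−1)v^{p−2}` resp. `−1/v`, `1/v²` there.

## References

* Z. Lei, Q. S. Zhang, J. Funct. Anal. 261 (2011) = arXiv:1011.5066, Lemma 3.4 (p. 11) and
  Lemma 3.2 (p. 9): the test functions `pΦ^{p−1}ψ²` and `ζ²/Φ̃`. [LeiZhang2011]
-/

noncomputable section

open Set Filter
open scoped Topology

namespace Literature.Analysis.FluidPDE

namespace LeiZhang2011

open Literature.Analysis.Pluripotential

/-- **The smooth clamp from below.** For `ε > 0`, `χ(v) = smoothMax (ε/4) v (ε/4)` is `C^∞`,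
`χ(v) = v` for `v ≥ ε/2`, `χ ≥ ε/4 > 0`, and `χ = id` near every `v > ε/2`. [folklore] -/
theorem clamp_props {ε : ℝ} (hε : 0 < ε) :
    (∀ n : ℕ∞, ContDiff ℝ n fun v : ℝ => smoothMax (ε / 4) v (ε / 4)) ∧
    (∀ v, ε / 2 ≤ v → smoothMax (ε / 4) v (ε / 4) = v) ∧
    (∀ v, ε / 4 ≤ smoothMax (ε / 4) v (ε / 4)) ∧
    (∀ v, ε / 2 < v → (fun w : ℝ => smoothMax (ε / 4) w (ε / 4)) =ᶠ[𝓝 v] fun w => w) := by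
  have hη : 0 < ε / 4 := by positivity
  have heq : ∀ v, ε / 2 ≤ v → smoothMax (ε / 4) v (ε / 4) = v := fun v hv =>
    smoothMax_eq_left hη (by linarith)
  refine ⟨fun n => ?_, heq, fun v => ?_, fun v hv => ?_⟩
  · exact (contDiff_smoothMax (η := ε / 4) (n := n)).comp (contDiff_id.prodMk contDiff_const)
  · exact (le_max_right _ _).trans (max_le_smoothMax hη v (ε / 4))
  · filter_upwards [Ioi_mem_nhds hv] with w hw
    exact heq w hw.le

/-- **The clamped power `H_p(v) = χ(v)^p`**: `C^∞`, positive, and with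
`H_p' = p v^{p−1}`, `H_p'' = p(p−1) v^{p−2}` at every `v > ε/2`. [cite: LeiZhang2011, Lemma 3.4 (arXiv p. 11), the test function pΦ^{p−1}ψ²] -/
theorem clampedPow_props {ε : ℝ} (hε : 0 < ε) (p : ℝ) :
    (∀ n : ℕ∞, ContDiff ℝ n fun v : ℝ => smoothMax (ε / 4) v (ε / 4) ^ p) ∧
    (∀ v, 0 < smoothMax (ε / 4) v (ε / 4) ^ p) ∧
    (∀ v, ε / 2 ≤ v → smoothMax (ε / 4) v (ε / 4) ^ p = v ^ p) ∧
    (∀ v, ε / 2 < v → deriv (fun w : ℝ => smoothMax (ε / 4) w (ε / 4) ^ p) v = p * v ^ (p - 1)) ∧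
    (∀ v, ε / 2 < v →
      deriv (deriv fun w : ℝ => smoothMax (ε / 4) w (ε / 4) ^ p) v = p * (p - 1) * v ^ (p - 2)) := by
  obtain ⟨hC, heq, hge, hev⟩ := clamp_props hε
  have hpos : ∀ v, 0 < smoothMax (ε / 4) v (ε / 4) := fun v => lt_of_lt_of_le (by positivity) (hge v)
  -- eventual equality with `w ↦ w^p` near `v > ε/2`, and of the derivatives
  have hev' : ∀ v, ε / 2 < v → (fun w : ℝ => smoothMax (ε / 4) w (ε / 4) ^ p) =ᶠ[𝓝 v] fun w => w ^ p := by
    intro v hv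
    filter_upwards [hev v hv] with w hw
    rw [show smoothMax (ε / 4) w (ε / 4) = w from hw]
  have hd1 : ∀ v, 0 < v → deriv (fun w : ℝ => w ^ p) v = p * v ^ (p - 1) := fun v hv =>
    Real.deriv_rpow_const v p
  refine ⟨fun n => (hC n).rpow_const_of_ne fun v => (hpos v).ne', fun v => Real.rpow_pos_of_pos (hpos v) _,
    fun v hv => by rw [heq v hv], fun v hv => ?_, fun v hv => ?_⟩
  · rw [(hev' v hv).deriv_eq, hd1 v (by linarith)]
  · have h1 : deriv (fun w : ℝ => smoothMax (ε / 4) w (ε / 4) ^ p) =ᶠ[𝓝 v] deriv fun w : ℝ => w ^ p :=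
      (hev' v hv).deriv
    have h2 : deriv (fun w : ℝ => w ^ p) =ᶠ[𝓝 v] fun w => p * w ^ (p - 1) := by
      filter_upwards [Ioi_mem_nhds (show (0 : ℝ) < v by linarith)] with w hw
      exact hd1 w hw
    rw [(h1.trans h2).deriv_eq]
    have h3 : deriv (fun w : ℝ => p * w ^ (p - 1)) v = p * ((p - 1) * v ^ (p - 1 - 1)) := by
      rw [deriv_const_mul _ ((Real.hasDerivAt_rpow_const (Or.inl (by linarith : v ≠ 0))).differentiableAt),
        Real.deriv_rpow_const]
    rw [h3, show p - 1 - 1 = p - 2 by ring]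
    ring

/-- **The clamped logarithm `H_log(v) = −log χ(v)`**: `C^∞`, and with `H_log' = −1/v`,
`H_log'' = 1/v²` at every `v > ε/2`. [cite: LeiZhang2011, Lemma 3.2 (arXiv p. 9), Ψ = −ln Φ̃] -/
theorem clampedNegLog_props {ε : ℝ} (hε : 0 < ε) :
    (∀ n : ℕ∞, ContDiff ℝ n fun v : ℝ => -Real.log (smoothMax (ε / 4) v (ε / 4))) ∧
    (∀ v, ε / 2 ≤ v → -Real.log (smoothMax (ε / 4) v (ε / 4)) = -Real.log v) ∧
    (∀ v, ε / 2 < v → deriv (fun w : ℝ => -Real.log (smoothMax (ε / 4) w (ε / 4))) v = -v⁻¹) ∧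
    (∀ v, ε / 2 < v →
      deriv (deriv fun w : ℝ => -Real.log (smoothMax (ε / 4) w (ε / 4))) v = (v ^ 2)⁻¹) := by
  obtain ⟨hC, heq, hge, hev⟩ := clamp_props hε
  have hpos : ∀ v, 0 < smoothMax (ε / 4) v (ε / 4) := fun v => lt_of_lt_of_le (by positivity) (hge v)
  have hev' : ∀ v, ε / 2 < v →
      (fun w : ℝ => -Real.log (smoothMax (ε / 4) w (ε / 4))) =ᶠ[𝓝 v] fun w => -Real.log w := by
    intro v hv
    filter_upwards [hev v hv] with w hw
    rw [show smoothMax (ε / 4) w (ε / 4) = w from hw]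
  have hd1 : ∀ v, 0 < v → deriv (fun w : ℝ => -Real.log w) v = -v⁻¹ := fun v hv => by
    have h : HasDerivAt (fun w : ℝ => -Real.log w) (-v⁻¹) v := (Real.hasDerivAt_log hv.ne').neg
    exact h.deriv
  refine ⟨fun n => ((hC n).log fun v => (hpos v).ne').neg, fun v hv => by rw [heq v hv],
    fun v hv => ?_, fun v hv => ?_⟩
  · rw [(hev' v hv).deriv_eq, hd1 v (by linarith)]
  · have h1 : deriv (fun w : ℝ => -Real.log (smoothMax (ε / 4) w (ε / 4))) =ᶠ[𝓝 v]
        deriv fun w : ℝ => -Real.log w := (hev' v hv).deriv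
    have h2 : deriv (fun w : ℝ => -Real.log w) =ᶠ[𝓝 v] fun w => -w⁻¹ := by
      filter_upwards [Ioi_mem_nhds (show (0 : ℝ) < v by linarith)] with w hw
      exact hd1 w hw
    rw [(h1.trans h2).deriv_eq]
    have h : HasDerivAt (fun w : ℝ => -w⁻¹) (-(-(v ^ 2)⁻¹)) v := (hasDerivAt_inv (by linarith : v ≠ 0)).neg
    rw [h.deriv]
    ring

end LeiZhang2011

end Literature.Analysis.FluidPDE
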